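import Mathlib
import HarnessLib
import Summits.HubbardSuperconductivity.HubbardSuperconductivity.Theorems.KLProgrammeKLRegimeTwoVolumeNormVKit

/-!
# Route `KLProgramme` — crux K3, VL child `KLRegimeVolumeLimitV17F2` (stmt-HubbardSuperconductivity-20440), blueprint v5 M5 / W4d (arithmetic): THE RIGHT-HAND
# SIDE OF THE GRID BASE DEFECT IS `ε ×` A SUM OF RATE-WEIGHTED CONSTANTS (seat hubbard-kl-k3c4-p1 g13; `--supports` 20440)

`…TowerBaseGrid.tower_base_grid_keyedDefect_le` bounds the keyed grid base defect by the frame-swap terms (small factors `sE`, `cR`, `cC`) plus M4a's five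
terms (small factors: the frame-mismatch budget `normV E`, the depth ratio `(1+R)/(R′+2)`, the covariance tails `Te`, `T`, and `(R′+1)⁻¹`).  When every kernel
profile is `ε ×` a volume-free majorant (`ε` = the imaginary-time weight) and the denominators are controlled by volume-free smallness numbers, the whole
right-hand side is `ε · (sE·A₁ + (cR+cC)·A₂ + eE·A₃ + q·A₄ + Te·A₅ + T·A₆ + (R′+1)⁻¹·A₇)` with EXPLICIT volume-free `Aᵢ` — the form the limit
`L → ∞` (`…TowerBaseGridLimit`) consumes.

* `towerBase_geomBlock_le`, `towerBase_geomBlockSq_le`, `towerBase_geomCoefSq_le` — monotonicity of the geometric majorant blocks;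
* **`tower_base_grid_rhs_le_eps_mul`** — the displayed inequality.

Proofs only; no definition.
-/

noncomputable section

namespace Summit.HubbardSuperconductivity.HubbardSuperconductivity.Theorems.TwoVolumeSource

set_option linter.dupNamespace false -- summit = problem name (single-conjunct summit), D-0017

open Finset Literature.MathematicalPhysics.QuantumLattice
open Summit.HubbardSuperconductivity.HubbardSuperconductivity.Theorems.TwoVolumeDefect

/-- Monotonicity of the geometric block `ρ⁻ʲ·e·ν/(1−θ)` in `ν ≤ t·ν′` and `θ ≤ θ′ < 1`. [folklore] -/
theorem towerBase_geomBlock_le {ρ ν ν' θ θ' t : ℝ} (j : ℕ) (hρ : 0 < ρ) (hν : 0 ≤ ν) (hνle : ν ≤ t * ν') (hθ : θ ≤ θ') (hθ' : θ' < 1) :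
    ρ⁻¹ ^ j * (Real.exp 1 * ν) / (1 - θ) ≤ t * (ρ⁻¹ ^ j * (Real.exp 1 * ν') / (1 - θ')) := by
  have h1 : 0 < 1 - θ' := sub_pos.2 hθ'
  have h2 : 1 - θ' ≤ 1 - θ := by linarith
  calc ρ⁻¹ ^ j * (Real.exp 1 * ν) / (1 - θ) ≤ ρ⁻¹ ^ j * (Real.exp 1 * ν) / (1 - θ') :=
        div_le_div_of_nonneg_left (by positivity) h1 h2
    _ ≤ ρ⁻¹ ^ j * (Real.exp 1 * (t * ν')) / (1 - θ') :=
        div_le_div_of_nonneg_right (mul_le_mul_of_nonneg_left (mul_le_mul_of_nonneg_left hνle (Real.exp_pos 1).le) (by positivity)) h1.le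
    _ = t * (ρ⁻¹ ^ j * (Real.exp 1 * ν') / (1 - θ')) := by ring

/-- Monotonicity of the squared-denominator block `ρ⁻ʲ·e·ν/(1−θ)²`. [folklore] -/
theorem towerBase_geomBlockSq_le {ρ ν ν' θ θ' t : ℝ} (j : ℕ) (hρ : 0 < ρ) (hν : 0 ≤ ν) (hνle : ν ≤ t * ν') (hθ : θ ≤ θ') (hθ' : θ' < 1) :
    ρ⁻¹ ^ j * (Real.exp 1 * ν) / (1 - θ) ^ 2 ≤ t * (ρ⁻¹ ^ j * (Real.exp 1 * ν') / (1 - θ') ^ 2) := by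
  have h1 : 0 < 1 - θ' := sub_pos.2 hθ'
  have h2 : (1 - θ') ^ 2 ≤ (1 - θ) ^ 2 := pow_le_pow_left₀ h1.le (by linarith) 2
  calc ρ⁻¹ ^ j * (Real.exp 1 * ν) / (1 - θ) ^ 2 ≤ ρ⁻¹ ^ j * (Real.exp 1 * ν) / (1 - θ') ^ 2 :=
        div_le_div_of_nonneg_left (by positivity) (by positivity) h2
    _ ≤ ρ⁻¹ ^ j * (Real.exp 1 * (t * ν')) / (1 - θ') ^ 2 :=
        div_le_div_of_nonneg_right (mul_le_mul_of_nonneg_left (mul_le_mul_of_nonneg_left hνle (Real.exp_pos 1).le) (by positivity)) (by positivity)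
    _ = t * (ρ⁻¹ ^ j * (Real.exp 1 * ν') / (1 - θ') ^ 2) := by ring

/-- Monotonicity of the coefficient block `ρ⁻ʲ·e/(1−θ)²` in `θ ≤ θ′ < 1`. [folklore] -/
theorem towerBase_geomCoefSq_le {ρ θ θ' : ℝ} (j : ℕ) (hρ : 0 < ρ) (hθ : θ ≤ θ') (hθ' : θ' < 1) :
    ρ⁻¹ ^ j * Real.exp 1 / (1 - θ) ^ 2 ≤ ρ⁻¹ ^ j * Real.exp 1 / (1 - θ') ^ 2 := by
  have h1 : 0 < 1 - θ' := sub_pos.2 hθ'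
  exact div_le_div_of_nonneg_left (by positivity) (by positivity) (pow_le_pow_left₀ h1.le (by linarith) 2)

set_option maxHeartbeats 800000 in -- long but elementary real arithmetic
/-- **THE RIGHT-HAND SIDE OF THE GRID BASE DEFECT IS `ε ×` A SUM OF RATE-WEIGHTED VOLUME-FREE CONSTANTS** (see the module docstring; the left side is
the right side of `…TowerBaseGrid.tower_base_grid_keyedDefect_le` over an arbitrary label type `Γ`). [folklore] -/
theorem tower_base_grid_rhs_le_eps_mul (Γ : Type) [Fintype Γ] (n : ℕ) {ε : ℝ} (hε : 0 ≤ ε) (hε1 : ε ≤ 1)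
    -- frame-swap part
    {sE cR cC cb αC κE ρS νW : ℝ} {NW : ℕ → ℝ} (hsE : 0 ≤ sE) (hcR : 0 ≤ cR) (hcC : 0 ≤ cC) (hcb : cR + cC ≤ cb) (hαC : 0 ≤ αC) (hκE : 0 < κE)
    (hρS : 0 < ρS) (hNW0 : ∀ m', 0 ≤ NW m') (hνW0 : 0 ≤ νW) (hνW : normV Γ κE ρS NW ≤ ε * νW) (hθS : Real.exp 1 * (αC + cb) * νW / κE ^ 2 < 1)
    -- M4a part
    {κ κ' ρ' ρ₂ ρf αw α α' m₁ m₁' s s' T Te νEbar eE νD Θ νf ν₂ : ℝ} {Nw NV ND E : ℕ → ℝ} (R R' : ℕ)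
    (hκ : 0 < κ) (hκ' : 0 < κ') (hρ' : 0 < ρ') (hρ₂ : 0 < ρ₂) (hρf : 0 < ρf) (hαw : 0 ≤ αw) (hαα : 0 ≤ α' + α) (hm : 0 ≤ m₁' + m₁) (hss : 0 ≤ s' + s)
    (hT : 0 ≤ T) (hTe : 0 ≤ Te) (hNw0 : ∀ m', 0 ≤ Nw m') (hND0 : ∀ m', 0 ≤ ND m') (hE0 : ∀ m', 0 ≤ E m')
    (heE : normV Γ κ' ρ' E ≤ ε * eE) (hνD : normV Γ κ' ρ' ND ≤ ε * ((1 + (R : ℝ)) * νD))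
    (hΘ1 : normV Γ κ' ρ' (fun m' => NV m' + ND m') + νEbar ≤ Θ) (hΘ2 : normV Γ κ' ρ' NV + normV Γ κ' ρ' ND ≤ Θ) (hθΘ : Real.exp 1 * αw * Θ / κ' ^ 2 < 1)
    (hνf0 : 0 ≤ νf) (hνf : normV Γ (κ' + κ) ρf Nw ≤ ε * νf) (hθf : Real.exp 1 * (α' + α + (m₁' + m₁)) * νf / (κ' + κ) ^ 2 < 1)
    (hν₂0 : 0 ≤ ν₂) (hν₂ : normV Γ (κ' + κ + (κ' + κ + (κ' + κ))) ρ₂ Nw ≤ ε * ν₂)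
    (hθ₂ : Real.exp 1 * (α' + α + (m₁' + m₁)) * ν₂ / (κ' + κ + (κ' + κ + (κ' + κ))) ^ 2 < 1) :
      (((((n + 1 + 1) * (n + 1 + 2) : ℕ) : ℝ) / 2 * sE *
          (ρS⁻¹ ^ (n + 3) * (Real.exp 1 * normV (Γ) κE ρS NW) /
            (1 - Real.exp 1 * (αC + (cR + cC)) * normV (Γ) κE ρS NW / κE ^ 2)) +
        ‖(2 : ℂ)⁻¹‖ * ∑ a' ∈ range (n + 2), ∑ b' ∈ range (n + 2),
          (if a' + b' = n + 1 then (((a' + 1) * (b' + 1) : ℕ) : ℝ) *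
            (cR * (ρS⁻¹ ^ (a' + 1) * (Real.exp 1 * normV (Γ) κE ρS NW) /
                  (1 - Real.exp 1 * (αC + (cR + cC)) * normV (Γ) κE ρS NW / κE ^ 2)) *
                (ρS⁻¹ ^ (b' + 1) * (Real.exp 1 * normV (Γ) κE ρS NW) /
                  (1 - Real.exp 1 * (αC + (cR + cC)) * normV (Γ) κE ρS NW / κE ^ 2)) +
              cC * (ρS⁻¹ ^ (a' + 1) * (Real.exp 1 * normV (Γ) κE ρS NW) /
                  (1 - Real.exp 1 * (αC + (cR + cC)) * normV (Γ) κE ρS NW / κE ^ 2)) *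
                (ρS⁻¹ ^ (b' + 1) * (Real.exp 1 * normV (Γ) κE ρS NW) /
                  (1 - Real.exp 1 * (αC + (cR + cC)) * normV (Γ) κE ρS NW / κE ^ 2))) else 0))) +
      ((ρ'⁻¹ ^ (n + 1) * Real.exp 1 / (1 - Real.exp 1 * αw * (normV (Γ) κ' ρ' (fun m' => NV m' + ND m') + νEbar) / κ' ^ 2) ^ 2) * normV (Γ) κ' ρ' E +
        (ρ'⁻¹ ^ (n + 1) * (Real.exp 1 * normV (Γ) κ' ρ' ND) / (1 - Real.exp 1 * αw * (normV (Γ) κ' ρ' NV + normV (Γ) κ' ρ' ND) / κ' ^ 2) ^ 2) * (1 + ((R' : ℝ) + 1))⁻¹ +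
        ((((n + 1 + 1) * (n + 1 + 2) : ℕ) : ℝ) / 2 *
            (ρ₂⁻¹ ^ (n + 3) * (Real.exp 1 * normV (Γ) (κ' + κ + (κ' + κ + (κ' + κ))) ρ₂ Nw) / (1 - Real.exp 1 * (α' + α + (m₁' + m₁)) * normV (Γ) (κ' + κ + (κ' + κ + (κ' + κ))) ρ₂ Nw / (κ' + κ + (κ' + κ + (κ' + κ))) ^ 2))) * Te +
        (‖(2 : ℂ)⁻¹‖ * ∑ a ∈ range (n + 2), ∑ b' ∈ range (n + 2),
            (if a + b' = n + 1 then (((a + 1) * (b' + 1) : ℕ) : ℝ) *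
              (4 * (ρ₂⁻¹ ^ (a + 1) * (Real.exp 1 * normV (Γ) (κ' + κ + (κ' + κ + (κ' + κ))) ρ₂ Nw) / (1 - Real.exp 1 * (α' + α + (m₁' + m₁)) * normV (Γ) (κ' + κ + (κ' + κ + (κ' + κ))) ρ₂ Nw / (κ' + κ + (κ' + κ + (κ' + κ))) ^ 2)) *
                (ρ₂⁻¹ ^ (b' + 1) * (Real.exp 1 * normV (Γ) (κ' + κ + (κ' + κ + (κ' + κ))) ρ₂ Nw) / (1 - Real.exp 1 * (α' + α + (m₁' + m₁)) * normV (Γ) (κ' + κ + (κ' + κ + (κ' + κ))) ρ₂ Nw / (κ' + κ + (κ' + κ + (κ' + κ))) ^ 2))) else 0)) * T +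
        ((((n + 1 + 1) * (n + 1 + 2) : ℕ) : ℝ) / 2 * (s' + s) *
              (ρf⁻¹ ^ (n + 3) * (Real.exp 1 * normV (Γ) (κ' + κ) ρf Nw) / (1 - Real.exp 1 * (α' + α + (m₁' + m₁)) * normV (Γ) (κ' + κ) ρf Nw / (κ' + κ) ^ 2)) +
            ‖(2 : ℂ)⁻¹‖ * ∑ a ∈ range (n + 2), ∑ b' ∈ range (n + 2),
              (if a + b' = n + 1 then (((a + 1) * (b' + 1) : ℕ) : ℝ) *
                (2 * (α' + α) * (ρf⁻¹ ^ (a + 1) * (Real.exp 1 * normV (Γ) (κ' + κ) ρf Nw) / (1 - Real.exp 1 * (α' + α + (m₁' + m₁)) * normV (Γ) (κ' + κ) ρf Nw / (κ' + κ) ^ 2)) *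
                  (ρf⁻¹ ^ (b' + 1) * (Real.exp 1 * normV (Γ) (κ' + κ) ρf Nw) / (1 - Real.exp 1 * (α' + α + (m₁' + m₁)) * normV (Γ) (κ' + κ) ρf Nw / (κ' + κ) ^ 2))) else 0)) * ((R' : ℝ) + 1)⁻¹) ≤
      ε * (sE * ((((n + 1 + 1) * (n + 1 + 2) : ℕ) : ℝ) / 2 * (ρS⁻¹ ^ (n + 3) * (Real.exp 1 * νW) / (1 - Real.exp 1 * (αC + cb) * νW / κE ^ 2))) +
        (cR + cC) * (‖(2 : ℂ)⁻¹‖ * ∑ a' ∈ range (n + 2), ∑ b' ∈ range (n + 2), (if a' + b' = n + 1 then (((a' + 1) * (b' + 1) : ℕ) : ℝ) * ((ρS⁻¹ ^ (a' + 1) * (Real.exp 1 * νW) / (1 - Real.exp 1 * (αC + cb) * νW / κE ^ 2)) * (ρS⁻¹ ^ (b' + 1) * (Real.exp 1 * νW) / (1 - Real.exp 1 * (αC + cb) * νW / κE ^ 2))) else 0)) +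
        eE * (ρ'⁻¹ ^ (n + 1) * Real.exp 1 / (1 - Real.exp 1 * αw * Θ / κ' ^ 2) ^ 2) +
        (1 + (R : ℝ)) / (1 + ((R' : ℝ) + 1)) * (ρ'⁻¹ ^ (n + 1) * (Real.exp 1 * νD) / (1 - Real.exp 1 * αw * Θ / κ' ^ 2) ^ 2) +
        Te * ((((n + 1 + 1) * (n + 1 + 2) : ℕ) : ℝ) / 2 * (ρ₂⁻¹ ^ (n + 3) * (Real.exp 1 * ν₂) / (1 - Real.exp 1 * (α' + α + (m₁' + m₁)) * ν₂ / (κ' + κ + (κ' + κ + (κ' + κ))) ^ 2))) +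
        T * (‖(2 : ℂ)⁻¹‖ * ∑ a ∈ range (n + 2), ∑ b' ∈ range (n + 2), (if a + b' = n + 1 then (((a + 1) * (b' + 1) : ℕ) : ℝ) * (4 * (ρ₂⁻¹ ^ (a + 1) * (Real.exp 1 * ν₂) / (1 - Real.exp 1 * (α' + α + (m₁' + m₁)) * ν₂ / (κ' + κ + (κ' + κ + (κ' + κ))) ^ 2)) * (ρ₂⁻¹ ^ (b' + 1) * (Real.exp 1 * ν₂) / (1 - Real.exp 1 * (α' + α + (m₁' + m₁)) * ν₂ / (κ' + κ + (κ' + κ + (κ' + κ))) ^ 2))) else 0)) +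
        ((R' : ℝ) + 1)⁻¹ * ((((n + 1 + 1) * (n + 1 + 2) : ℕ) : ℝ) / 2 * (s' + s) * (ρf⁻¹ ^ (n + 3) * (Real.exp 1 * νf) / (1 - Real.exp 1 * (α' + α + (m₁' + m₁)) * νf / (κ' + κ) ^ 2)) + ‖(2 : ℂ)⁻¹‖ * ∑ a ∈ range (n + 2), ∑ b' ∈ range (n + 2), (if a + b' = n + 1 then (((a + 1) * (b' + 1) : ℕ) : ℝ) * (2 * (α' + α) * (ρf⁻¹ ^ (a + 1) * (Real.exp 1 * νf) / (1 - Real.exp 1 * (α' + α + (m₁' + m₁)) * νf / (κ' + κ) ^ 2)) * (ρf⁻¹ ^ (b' + 1) * (Real.exp 1 * νf) / (1 - Real.exp 1 * (α' + α + (m₁' + m₁)) * νf / (κ' + κ) ^ 2))) else 0))) := by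
  have he0 : 0 < Real.exp 1 := Real.exp_pos 1
  have hcb0 : 0 ≤ cb := (add_nonneg hcR hcC).trans hcb
  -- §A the frame-swap blocks
  have hXW0 : 0 ≤ normV Γ κE ρS NW := normV_nonneg hκE.le hρS.le hNW0
  have hXWle : normV Γ κE ρS NW ≤ νW := hνW.trans (mul_le_of_le_one_left hνW0 hε1)
  have hθSi : Real.exp 1 * (αC + (cR + cC)) * normV Γ κE ρS NW / κE ^ 2 ≤ Real.exp 1 * (αC + cb) * νW / κE ^ 2 :=
    div_le_div_of_nonneg_right (mul_le_mul (mul_le_mul_of_nonneg_left (by linarith) he0.le) hXWle hXW0 (by positivity)) (sq_nonneg _)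
  have hGS : ∀ j : ℕ, (ρS⁻¹ ^ (j) * (Real.exp 1 * normV Γ κE ρS NW) / (1 - Real.exp 1 * (αC + (cR + cC)) * normV Γ κE ρS NW / κE ^ 2)) ≤ ε * (ρS⁻¹ ^ (j) * (Real.exp 1 * νW) / (1 - Real.exp 1 * (αC + cb) * νW / κE ^ 2)) := fun j => towerBase_geomBlock_le j hρS hXW0 hνW hθSi hθS
  have hGS' : ∀ j : ℕ, (ρS⁻¹ ^ (j) * (Real.exp 1 * normV Γ κE ρS NW) / (1 - Real.exp 1 * (αC + (cR + cC)) * normV Γ κE ρS NW / κE ^ 2)) ≤ (ρS⁻¹ ^ (j) * (Real.exp 1 * νW) / (1 - Real.exp 1 * (αC + cb) * νW / κE ^ 2)) := fun j => by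
    have h := towerBase_geomBlock_le (t := 1) (ν' := νW) j hρS hXW0 (by rw [one_mul]; exact hXWle) hθSi hθS
    rwa [one_mul] at h
  have hGS0 : ∀ j : ℕ, 0 ≤ (ρS⁻¹ ^ (j) * (Real.exp 1 * νW) / (1 - Real.exp 1 * (αC + cb) * νW / κE ^ 2)) := fun j => div_nonneg (by positivity) (sub_pos.2 hθS).le
  have hGSi0 : ∀ j : ℕ, 0 ≤ (ρS⁻¹ ^ (j) * (Real.exp 1 * normV Γ κE ρS NW) / (1 - Real.exp 1 * (αC + (cR + cC)) * normV Γ κE ρS NW / κE ^ 2)) := fun j => div_nonneg (by positivity) (by linarith)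
  -- term 1
  have h1 : ((((n + 1 + 1) * (n + 1 + 2) : ℕ) : ℝ) / 2) * sE * (ρS⁻¹ ^ (n + 3) * (Real.exp 1 * normV Γ κE ρS NW) / (1 - Real.exp 1 * (αC + (cR + cC)) * normV Γ κE ρS NW / κE ^ 2)) ≤ ε * (sE * (((((n + 1 + 1) * (n + 1 + 2) : ℕ) : ℝ) / 2) * (ρS⁻¹ ^ (n + 3) * (Real.exp 1 * νW) / (1 - Real.exp 1 * (αC + cb) * νW / κE ^ 2)))) :=
    calc ((((n + 1 + 1) * (n + 1 + 2) : ℕ) : ℝ) / 2) * sE * (ρS⁻¹ ^ (n + 3) * (Real.exp 1 * normV Γ κE ρS NW) / (1 - Real.exp 1 * (αC + (cR + cC)) * normV Γ κE ρS NW / κE ^ 2)) ≤ ((((n + 1 + 1) * (n + 1 + 2) : ℕ) : ℝ) / 2) * sE * (ε * (ρS⁻¹ ^ (n + 3) * (Real.exp 1 * νW) / (1 - Real.exp 1 * (αC + cb) * νW / κE ^ 2))) := mul_le_mul_of_nonneg_left (hGS _) (by positivity)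
      _ = ε * (sE * (((((n + 1 + 1) * (n + 1 + 2) : ℕ) : ℝ) / 2) * (ρS⁻¹ ^ (n + 3) * (Real.exp 1 * νW) / (1 - Real.exp 1 * (αC + cb) * νW / κE ^ 2)))) := by ring
  -- term 2
  have h2 : ‖(2 : ℂ)⁻¹‖ * ∑ a' ∈ range (n + 2), ∑ b' ∈ range (n + 2),
      (if a' + b' = n + 1 then (((a' + 1) * (b' + 1) : ℕ) : ℝ) * (cR * (ρS⁻¹ ^ (a' + 1) * (Real.exp 1 * normV Γ κE ρS NW) / (1 - Real.exp 1 * (αC + (cR + cC)) * normV Γ κE ρS NW / κE ^ 2)) * (ρS⁻¹ ^ (b' + 1) * (Real.exp 1 * normV Γ κE ρS NW) / (1 - Real.exp 1 * (αC + (cR + cC)) * normV Γ κE ρS NW / κE ^ 2)) + cC * (ρS⁻¹ ^ (a' + 1) * (Real.exp 1 * normV Γ κE ρS NW) / (1 - Real.exp 1 * (αC + (cR + cC)) * normV Γ κE ρS NW / κE ^ 2)) * (ρS⁻¹ ^ (b' + 1) * (Real.exp 1 * normV Γ κE ρS NW) / (1 - Real.exp 1 * (αC + (cR + cC)) * normV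 Γ κE ρS NW / κE ^ 2))) else 0) ≤
      ε * ((cR + cC) * (‖(2 : ℂ)⁻¹‖ * ∑ a' ∈ range (n + 2), ∑ b' ∈ range (n + 2), (if a' + b' = n + 1 then (((a' + 1) * (b' + 1) : ℕ) : ℝ) * ((ρS⁻¹ ^ (a' + 1) * (Real.exp 1 * νW) / (1 - Real.exp 1 * (αC + cb) * νW / κE ^ 2)) * (ρS⁻¹ ^ (b' + 1) * (Real.exp 1 * νW) / (1 - Real.exp 1 * (αC + cb) * νW / κE ^ 2))) else 0))) := by
    have hs : ∑ a' ∈ range (n + 2), ∑ b' ∈ range (n + 2),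
        (if a' + b' = n + 1 then (((a' + 1) * (b' + 1) : ℕ) : ℝ) * (cR * (ρS⁻¹ ^ (a' + 1) * (Real.exp 1 * normV Γ κE ρS NW) / (1 - Real.exp 1 * (αC + (cR + cC)) * normV Γ κE ρS NW / κE ^ 2)) * (ρS⁻¹ ^ (b' + 1) * (Real.exp 1 * normV Γ κE ρS NW) / (1 - Real.exp 1 * (αC + (cR + cC)) * normV Γ κE ρS NW / κE ^ 2)) + cC * (ρS⁻¹ ^ (a' + 1) * (Real.exp 1 * normV Γ κE ρS NW) / (1 - Real.exp 1 * (αC + (cR + cC)) * normV Γ κE ρS NW / κE ^ 2)) * (ρS⁻¹ ^ (b' + 1) * (Real.exp 1 * normV Γ κE ρS NW) / (1 - Real.exp 1 * (αC + (cR + cC)) * normV Γ κE ρS NW / κE ^ 2))) else 0) ≤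
        ∑ a' ∈ range (n + 2), ∑ b' ∈ range (n + 2), (cR + cC) * ε *
          (if a' + b' = n + 1 then (((a' + 1) * (b' + 1) : ℕ) : ℝ) * ((ρS⁻¹ ^ (a' + 1) * (Real.exp 1 * νW) / (1 - Real.exp 1 * (αC + cb) * νW / κE ^ 2)) * (ρS⁻¹ ^ (b' + 1) * (Real.exp 1 * νW) / (1 - Real.exp 1 * (αC + cb) * νW / κE ^ 2))) else 0) := by
      refine sum_le_sum fun a' _ => sum_le_sum fun b' _ => ?_
      split_ifs
      · have hP : (ρS⁻¹ ^ (a' + 1) * (Real.exp 1 * normV Γ κE ρS NW) / (1 - Real.exp 1 * (αC + (cR + cC)) * normV Γ κE ρS NW / κE ^ 2)) * (ρS⁻¹ ^ (b' + 1) * (Real.exp 1 * normV Γ κE ρS NW) / (1 - Real.exp 1 * (αC + (cR + cC)) * normV Γ κE ρS NW / κE ^ 2)) ≤ ε * (ρS⁻¹ ^ (a' + 1) * (Real.exp 1 * νW) / (1 - Real.exp 1 * (αC + cb) * νW / κE ^ 2)) * (ρS⁻¹ ^ (b' + 1) * (Real.exp 1 * νW) / (1 - Real.exp 1 * (αC +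 cb) * νW / κE ^ 2)) :=
          mul_le_mul (hGS _) (hGS' _) (hGSi0 _) (mul_nonneg hε (hGS0 _))
        have hA : (0 : ℝ) ≤ (((a' + 1) * (b' + 1) : ℕ) : ℝ) := by positivity
        calc (((a' + 1) * (b' + 1) : ℕ) : ℝ) * (cR * (ρS⁻¹ ^ (a' + 1) * (Real.exp 1 * normV Γ κE ρS NW) / (1 - Real.exp 1 * (αC + (cR + cC)) * normV Γ κE ρS NW / κE ^ 2)) * (ρS⁻¹ ^ (b' + 1) * (Real.exp 1 * normV Γ κE ρS NW) / (1 - Real.exp 1 * (αC + (cR + cC)) * normV Γ κE ρS NW / κE ^ 2)) + cC * (ρS⁻¹ ^ (a' + 1) * (Real.exp 1 * normV Γ κE ρS NW) / (1 - Real.exp 1 * (αC + (cR + cC)) * normV Γ κE ρS NW / κE ^ 2)) * (ρS⁻¹ ^ (b' + 1) * (Real.exp 1 * normV Γ κE ρS NW) / (1 - Real.exp 1 * (αC + (cR + cC)) * normV Γ κE ρS NW / κE ^ 2)))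
            = (cR + cC) * ((((a' + 1) * (b' + 1) : ℕ) : ℝ) * ((ρS⁻¹ ^ (a' + 1) * (Real.exp 1 * normV Γ κE ρS NW) / (1 - Real.exp 1 * (αC + (cR + cC)) * normV Γ κE ρS NW / κE ^ 2)) * (ρS⁻¹ ^ (b' + 1) * (Real.exp 1 * normV Γ κE ρS NW) / (1 - Real.exp 1 * (αC + (cR + cC)) * normV Γ κE ρS NW / κE ^ 2)))) := by ring
          _ ≤ (cR + cC) * ((((a' + 1) * (b' + 1) : ℕ) : ℝ) * (ε * (ρS⁻¹ ^ (a' + 1) * (Real.exp 1 * νW) / (1 - Real.exp 1 * (αC + cb) * νW / κE ^ 2)) * (ρS⁻¹ ^ (b' + 1) * (Real.exp 1 * νW) / (1 - Real.exp 1 * (αC + cb) * νW / κE ^ 2)))) :=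
            mul_le_mul_of_nonneg_left (mul_le_mul_of_nonneg_left hP hA) (add_nonneg hcR hcC)
          _ = (cR + cC) * ε * ((((a' + 1) * (b' + 1) : ℕ) : ℝ) * ((ρS⁻¹ ^ (a' + 1) * (Real.exp 1 * νW) / (1 - Real.exp 1 * (αC + cb) * νW / κE ^ 2)) * (ρS⁻¹ ^ (b' + 1) * (Real.exp 1 * νW) / (1 - Real.exp 1 * (αC + cb) * νW / κE ^ 2)))) := by ring
      · rw [mul_zero]
    simp_rw [← Finset.mul_sum] at hs
    calc ‖(2 : ℂ)⁻¹‖ * _ ≤ ‖(2 : ℂ)⁻¹‖ * ((cR + cC) * ε * ∑ a' ∈ range (n + 2), ∑ b' ∈ range (n + 2),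
          (if a' + b' = n + 1 then (((a' + 1) * (b' + 1) : ℕ) : ℝ) * ((ρS⁻¹ ^ (a' + 1) * (Real.exp 1 * νW) / (1 - Real.exp 1 * (αC + cb) * νW / κE ^ 2)) * (ρS⁻¹ ^ (b' + 1) * (Real.exp 1 * νW) / (1 - Real.exp 1 * (αC + cb) * νW / κE ^ 2))) else 0)) :=
        mul_le_mul_of_nonneg_left hs (norm_nonneg _)
      _ = ε * ((cR + cC) * (‖(2 : ℂ)⁻¹‖ * ∑ a' ∈ range (n + 2), ∑ b' ∈ range (n + 2), (if a' + b' = n + 1 then (((a' + 1) * (b' + 1) : ℕ) : ℝ) * ((ρS⁻¹ ^ (a' + 1) * (Real.exp 1 * νW) / (1 - Real.exp 1 * (αC + cb) * νW / κE ^ 2)) * (ρS⁻¹ ^ (b' + 1) * (Real.exp 1 * νW) / (1 - Real.exp 1 * (αC + cb) * νW / κE ^ 2))) else 0))) := by ring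
  -- §B M4a's blocks
  have hθ1i : Real.exp 1 * αw * (normV Γ κ' ρ' (fun m' => NV m' + ND m') + νEbar) / κ' ^ 2 ≤ Real.exp 1 * αw * Θ / κ' ^ 2 := div_le_div_of_nonneg_right (mul_le_mul_of_nonneg_left hΘ1 (by positivity)) (sq_nonneg _)
  have hθ2i : Real.exp 1 * αw * (normV Γ κ' ρ' NV + normV Γ κ' ρ' ND) / κ' ^ 2 ≤ Real.exp 1 * αw * Θ / κ' ^ 2 := div_le_div_of_nonneg_right (mul_le_mul_of_nonneg_left hΘ2 (by positivity)) (sq_nonneg _)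
  have hA3_0 : 0 ≤ (ρ'⁻¹ ^ (n + 1) * Real.exp 1 / (1 - Real.exp 1 * αw * Θ / κ' ^ 2) ^ 2) := div_nonneg (by positivity) (sq_nonneg _)
  -- term 3
  have h3 : ρ'⁻¹ ^ (n + 1) * Real.exp 1 / (1 - Real.exp 1 * αw * (normV Γ κ' ρ' (fun m' => NV m' + ND m') + νEbar) / κ' ^ 2) ^ 2 * normV Γ κ' ρ' E ≤ ε * (eE * (ρ'⁻¹ ^ (n + 1) * Real.exp 1 / (1 - Real.exp 1 * αw * Θ / κ' ^ 2) ^ 2)) :=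
    calc ρ'⁻¹ ^ (n + 1) * Real.exp 1 / (1 - Real.exp 1 * αw * (normV Γ κ' ρ' (fun m' => NV m' + ND m') + νEbar) / κ' ^ 2) ^ 2 * normV Γ κ' ρ' E ≤ (ρ'⁻¹ ^ (n + 1) * Real.exp 1 / (1 - Real.exp 1 * αw * Θ / κ' ^ 2) ^ 2) * (ε * eE) :=
          mul_le_mul (towerBase_geomCoefSq_le (n + 1) hρ' hθ1i hθΘ) heE (normV_nonneg hκ'.le hρ'.le hE0) hA3_0
      _ = ε * (eE * (ρ'⁻¹ ^ (n + 1) * Real.exp 1 / (1 - Real.exp 1 * αw * Θ / κ' ^ 2) ^ 2)) := by ring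
  -- term 4
  have h4 : ρ'⁻¹ ^ (n + 1) * (Real.exp 1 * normV Γ κ' ρ' ND) / (1 - Real.exp 1 * αw * (normV Γ κ' ρ' NV + normV Γ κ' ρ' ND) / κ' ^ 2) ^ 2 * (1 + ((R' : ℝ) + 1))⁻¹ ≤
      ε * ((1 + (R : ℝ)) / (1 + ((R' : ℝ) + 1)) * (ρ'⁻¹ ^ (n + 1) * (Real.exp 1 * νD) / (1 - Real.exp 1 * αw * Θ / κ' ^ 2) ^ 2)) := by
    have hb := towerBase_geomBlockSq_le (t := ε * (1 + (R : ℝ))) (n + 1) hρ' (normV_nonneg hκ'.le hρ'.le hND0) (by rw [mul_assoc]; exact hνD) hθ2i hθΘ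
    have hq : (0 : ℝ) ≤ (1 + ((R' : ℝ) + 1))⁻¹ := by positivity
    calc ρ'⁻¹ ^ (n + 1) * (Real.exp 1 * normV Γ κ' ρ' ND) / (1 - Real.exp 1 * αw * (normV Γ κ' ρ' NV + normV Γ κ' ρ' ND) / κ' ^ 2) ^ 2 * (1 + ((R' : ℝ) + 1))⁻¹
        ≤ ε * (1 + (R : ℝ)) * (ρ'⁻¹ ^ (n + 1) * (Real.exp 1 * νD) / (1 - Real.exp 1 * αw * Θ / κ' ^ 2) ^ 2) * (1 + ((R' : ℝ) + 1))⁻¹ := mul_le_mul_of_nonneg_right hb hq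
      _ = ε * ((1 + (R : ℝ)) / (1 + ((R' : ℝ) + 1)) * (ρ'⁻¹ ^ (n + 1) * (Real.exp 1 * νD) / (1 - Real.exp 1 * αw * Θ / κ' ^ 2) ^ 2)) := by rw [div_eq_mul_inv]; ring
  -- the `Nw` blocks at the two radii
  have hX20 : 0 ≤ normV Γ (κ' + κ + (κ' + κ + (κ' + κ))) ρ₂ Nw := normV_nonneg (by positivity) hρ₂.le hNw0
  have hX2le : normV Γ (κ' + κ + (κ' + κ + (κ' + κ))) ρ₂ Nw ≤ ν₂ := hν₂.trans (mul_le_of_le_one_left hν₂0 hε1)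
  have hθ₂i : Real.exp 1 * (α' + α + (m₁' + m₁)) * normV Γ (κ' + κ + (κ' + κ + (κ' + κ))) ρ₂ Nw / (κ' + κ + (κ' + κ + (κ' + κ))) ^ 2 ≤ Real.exp 1 * (α' + α + (m₁' + m₁)) * ν₂ / (κ' + κ + (κ' + κ + (κ' + κ))) ^ 2 :=
    div_le_div_of_nonneg_right (mul_le_mul_of_nonneg_left hX2le (by positivity)) (sq_nonneg _)
  have hG2 : ∀ j : ℕ, (ρ₂⁻¹ ^ (j) * (Real.exp 1 * normV Γ (κ' + κ + (κ' + κ + (κ' + κ))) ρ₂ Nw) / (1 - Real.exp 1 * (α' + α + (m₁' + m₁)) * normV Γ (κ' + κ + (κ' + κ + (κ' + κ))) ρ₂ Nw / (κ' + κ + (κ' + κ + (κ' + κ))) ^ 2)) ≤ ε * (ρ₂⁻¹ ^ (j) * (Real.exp 1 * ν₂) / (1 - Real.exp 1 * (α' + α + (m₁' + m₁)) * ν₂ / (κ' + κ + (κ' + κ + (κ' + κ))) ^ 2)) := fun j => towerBase_geomBlock_le j hρ₂ hX20 hν₂ hθ₂i hθ₂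
  have hG2' : ∀ j : ℕ, (ρ₂⁻¹ ^ (j) * (Real.exp 1 * normV Γ (κ' + κ + (κ' + κ + (κ' + κ))) ρ₂ Nw) / (1 - Real.exp 1 * (α' + α + (m₁' + m₁)) * normV Γ (κ' + κ + (κ' + κ + (κ' + κ))) ρ₂ Nw / (κ' + κ + (κ' + κ + (κ' + κ))) ^ 2)) ≤ (ρ₂⁻¹ ^ (j) * (Real.exp 1 * ν₂) / (1 - Real.exp 1 * (α' + α + (m₁' + m₁)) * ν₂ / (κ' + κ + (κ' + κ + (κ' + κ))) ^ 2)) := fun j => by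
    have h := towerBase_geomBlock_le (t := 1) (ν' := ν₂) j hρ₂ hX20 (by rw [one_mul]; exact hX2le) hθ₂i hθ₂
    rwa [one_mul] at h
  have hG20 : ∀ j : ℕ, 0 ≤ (ρ₂⁻¹ ^ (j) * (Real.exp 1 * ν₂) / (1 - Real.exp 1 * (α' + α + (m₁' + m₁)) * ν₂ / (κ' + κ + (κ' + κ + (κ' + κ))) ^ 2)) := fun j => div_nonneg (by positivity) (sub_pos.2 hθ₂).le
  have hG2i0 : ∀ j : ℕ, 0 ≤ (ρ₂⁻¹ ^ (j) * (Real.exp 1 * normV Γ (κ' + κ + (κ' + κ + (κ' + κ))) ρ₂ Nw) / (1 - Real.exp 1 * (α' + α + (m₁' + m₁)) * normV Γ (κ' + κ + (κ' + κ + (κ' + κ))) ρ₂ Nw / (κ' + κ + (κ' + κ + (κ' + κ))) ^ 2)) := fun j => div_nonneg (by positivity) (by linarith)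
  have hXf0 : 0 ≤ normV Γ (κ' + κ) ρf Nw := normV_nonneg (by positivity) hρf.le hNw0
  have hXfle : normV Γ (κ' + κ) ρf Nw ≤ νf := hνf.trans (mul_le_of_le_one_left hνf0 hε1)
  have hθfi : Real.exp 1 * (α' + α + (m₁' + m₁)) * normV Γ (κ' + κ) ρf Nw / (κ' + κ) ^ 2 ≤ Real.exp 1 * (α' + α + (m₁' + m₁)) * νf / (κ' + κ) ^ 2 :=
    div_le_div_of_nonneg_right (mul_le_mul_of_nonneg_left hXfle (by positivity)) (sq_nonneg _)
  have hGf : ∀ j : ℕ, (ρf⁻¹ ^ (j) * (Real.exp 1 * normV Γ (κ' + κ) ρf Nw) / (1 - Real.exp 1 * (α' + α + (m₁' + m₁)) * normV Γ (κ' + κ) ρf Nw / (κ' + κ) ^ 2)) ≤ ε * (ρf⁻¹ ^ (j) * (Real.exp 1 * νf) / (1 - Real.exp 1 * (α' + α + (m₁' + m₁)) * νf / (κ' + κ) ^ 2)) := fun j => towerBase_geomBlock_le j hρf hXf0 hνf hθfi hθf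
  have hGf' : ∀ j : ℕ, (ρf⁻¹ ^ (j) * (Real.exp 1 * normV Γ (κ' + κ) ρf Nw) / (1 - Real.exp 1 * (α' + α + (m₁' + m₁)) * normV Γ (κ' + κ) ρf Nw / (κ' + κ) ^ 2)) ≤ (ρf⁻¹ ^ (j) * (Real.exp 1 * νf) / (1 - Real.exp 1 * (α' + α + (m₁' + m₁)) * νf / (κ' + κ) ^ 2)) := fun j => by
    have h := towerBase_geomBlock_le (t := 1) (ν' := νf) j hρf hXf0 (by rw [one_mul]; exact hXfle) hθfi hθf
    rwa [one_mul] at h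
  have hGf0 : ∀ j : ℕ, 0 ≤ (ρf⁻¹ ^ (j) * (Real.exp 1 * νf) / (1 - Real.exp 1 * (α' + α + (m₁' + m₁)) * νf / (κ' + κ) ^ 2)) := fun j => div_nonneg (by positivity) (sub_pos.2 hθf).le
  have hGfi0 : ∀ j : ℕ, 0 ≤ (ρf⁻¹ ^ (j) * (Real.exp 1 * normV Γ (κ' + κ) ρf Nw) / (1 - Real.exp 1 * (α' + α + (m₁' + m₁)) * normV Γ (κ' + κ) ρf Nw / (κ' + κ) ^ 2)) := fun j => div_nonneg (by positivity) (by linarith)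
  -- term 5
  have h5 : ((((n + 1 + 1) * (n + 1 + 2) : ℕ) : ℝ) / 2) * (ρ₂⁻¹ ^ (n + 3) * (Real.exp 1 * normV Γ (κ' + κ + (κ' + κ + (κ' + κ))) ρ₂ Nw) / (1 - Real.exp 1 * (α' + α + (m₁' + m₁)) * normV Γ (κ' + κ + (κ' + κ + (κ' + κ))) ρ₂ Nw / (κ' + κ + (κ' + κ + (κ' + κ))) ^ 2)) * Te ≤ ε * (Te * (((((n + 1 + 1) * (n + 1 + 2) : ℕ) : ℝ) / 2) * (ρ₂⁻¹ ^ (n + 3) * (Real.exp 1 * ν₂) / (1 - Real.exp 1 * (α' + α + (m₁' + m₁)) * ν₂ / (κ' + κ + (κ' + κ + (κ' + κ))) ^ 2)))) :=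
    calc ((((n + 1 + 1) * (n + 1 + 2) : ℕ) : ℝ) / 2) * (ρ₂⁻¹ ^ (n + 3) * (Real.exp 1 * normV Γ (κ' + κ + (κ' + κ + (κ' + κ))) ρ₂ Nw) / (1 - Real.exp 1 * (α' + α + (m₁' + m₁)) * normV Γ (κ' + κ + (κ' + κ + (κ' + κ))) ρ₂ Nw / (κ' + κ + (κ' + κ + (κ' + κ))) ^ 2)) * Te ≤ ((((n + 1 + 1) * (n + 1 + 2) : ℕ) : ℝ) / 2) * (ε * (ρ₂⁻¹ ^ (n + 3) * (Real.exp 1 * ν₂) / (1 - Real.exp 1 * (α' + α + (m₁' + m₁)) * ν₂ / (κ' + κ + (κ' + κ + (κ' + κ))) ^ 2))) * Te :=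
          mul_le_mul_of_nonneg_right (mul_le_mul_of_nonneg_left (hG2 _) (by positivity)) hTe
      _ = ε * (Te * (((((n + 1 + 1) * (n + 1 + 2) : ℕ) : ℝ) / 2) * (ρ₂⁻¹ ^ (n + 3) * (Real.exp 1 * ν₂) / (1 - Real.exp 1 * (α' + α + (m₁' + m₁)) * ν₂ / (κ' + κ + (κ' + κ + (κ' + κ))) ^ 2)))) := by ring
  -- term 6
  have h6 : ‖(2 : ℂ)⁻¹‖ * (∑ a ∈ range (n + 2), ∑ b' ∈ range (n + 2),
      (if a + b' = n + 1 then (((a + 1) * (b' + 1) : ℕ) : ℝ) * (4 * (ρ₂⁻¹ ^ (a + 1) * (Real.exp 1 * normV Γ (κ' + κ + (κ' + κ + (κ' + κ))) ρ₂ Nw) / (1 - Real.exp 1 * (α' + α + (m₁' + m₁)) * normV Γ (κ' + κ + (κ' + κ + (κ' + κ))) ρ₂ Nw / (κ' + κ + (κ' + κ + (κ' + κ))) ^ 2)) * (ρ₂⁻¹ ^ (b' + 1) * (Real.exp 1 * normV Γ (κ' + κ + (κ' + κ + (κ' + κ))) ρ₂ Nw) / (1 - Real.exp 1 * (α' + α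 + (m₁' + m₁)) * normV Γ (κ' + κ + (κ' + κ + (κ' + κ))) ρ₂ Nw / (κ' + κ + (κ' + κ + (κ' + κ))) ^ 2))) else 0)) * T ≤ ε * (T * (‖(2 : ℂ)⁻¹‖ * ∑ a ∈ range (n + 2), ∑ b' ∈ range (n + 2), (if a + b' = n + 1 then (((a + 1) * (b' + 1) : ℕ) : ℝ) * (4 * (ρ₂⁻¹ ^ (a + 1) * (Real.exp 1 * ν₂) / (1 - Real.exp 1 * (α' + α + (m₁' + m₁)) * ν₂ / (κ' + κ + (κ' + κ + (κ' + κ))) ^ 2)) * (ρ₂⁻¹ ^ (b' + 1) * (Real.exp 1 * ν₂) / (1 - Real.exp 1 * (α' + α + (m₁' + m₁)) * ν₂ / (κ' + κ + (κ' + κ + (κ' + κ))) ^ 2))) else 0))) := by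
    have hs : ∑ a ∈ range (n + 2), ∑ b' ∈ range (n + 2),
        (if a + b' = n + 1 then (((a + 1) * (b' + 1) : ℕ) : ℝ) * (4 * (ρ₂⁻¹ ^ (a + 1) * (Real.exp 1 * normV Γ (κ' + κ + (κ' + κ + (κ' + κ))) ρ₂ Nw) / (1 - Real.exp 1 * (α' + α + (m₁' + m₁)) * normV Γ (κ' + κ + (κ' + κ + (κ' + κ))) ρ₂ Nw / (κ' + κ + (κ' + κ + (κ' + κ))) ^ 2)) * (ρ₂⁻¹ ^ (b' + 1) * (Real.exp 1 * normV Γ (κ' + κ + (κ' + κ + (κ' + κ))) ρ₂ Nw) / (1 - Real.exp 1 * (α' + α + (m₁' + m₁)) * normV Γ (κ' + κ + (κ' + κ + (κ' + κ))) ρ₂ Nw / (κ' + κ + (κ' + κ + (κ' + κ))) ^ 2))) else 0) ≤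
        ∑ a ∈ range (n + 2), ∑ b' ∈ range (n + 2), ε *
          (if a + b' = n + 1 then (((a + 1) * (b' + 1) : ℕ) : ℝ) * (4 * (ρ₂⁻¹ ^ (a + 1) * (Real.exp 1 * ν₂) / (1 - Real.exp 1 * (α' + α + (m₁' + m₁)) * ν₂ / (κ' + κ + (κ' + κ + (κ' + κ))) ^ 2)) * (ρ₂⁻¹ ^ (b' + 1) * (Real.exp 1 * ν₂) / (1 - Real.exp 1 * (α' + α + (m₁' + m₁)) * ν₂ / (κ' + κ + (κ' + κ + (κ' + κ))) ^ 2))) else 0) := by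
      refine sum_le_sum fun a _ => sum_le_sum fun b' _ => ?_
      split_ifs
      · have hP : (ρ₂⁻¹ ^ (a + 1) * (Real.exp 1 * normV Γ (κ' + κ + (κ' + κ + (κ' + κ))) ρ₂ Nw) / (1 - Real.exp 1 * (α' + α + (m₁' + m₁)) * normV Γ (κ' + κ + (κ' + κ + (κ' + κ))) ρ₂ Nw / (κ' + κ + (κ' + κ + (κ' + κ))) ^ 2)) * (ρ₂⁻¹ ^ (b' + 1) * (Real.exp 1 * normV Γ (κ' + κ + (κ' + κ + (κ' + κ))) ρ₂ Nw) / (1 - Real.exp 1 * (α' + α + (m₁' + m₁)) * normV Γ (κ' + κ + (κ' + κ + (κ' + κ))) ρ₂ Nw / (κ' + κ + (κ' + κ + (κ' + κ))) ^ 2)) ≤ ε * (ρ₂⁻¹ ^ (a + 1) * (Real.exp 1 * ν₂) / (1 - Real.exp 1 * (α' + α + (m₁' + m₁)) * ν₂ / (κ' + κ + (κ' + κ + (κ' + κ))) ^ 2)) * (ρ₂⁻¹ ^ (b' + 1) * (Real.exp 1 * ν₂) / (1 - Real.exp 1 * (α' + α + (m₁' + m₁)) * ν₂ / (κ' + κ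 + (κ' + κ + (κ' + κ))) ^ 2)) :=
          mul_le_mul (hG2 _) (hG2' _) (hG2i0 _) (mul_nonneg hε (hG20 _))
        have hA : (0 : ℝ) ≤ (((a + 1) * (b' + 1) : ℕ) : ℝ) := by positivity
        calc (((a + 1) * (b' + 1) : ℕ) : ℝ) * (4 * (ρ₂⁻¹ ^ (a + 1) * (Real.exp 1 * normV Γ (κ' + κ + (κ' + κ + (κ' + κ))) ρ₂ Nw) / (1 - Real.exp 1 * (α' + α + (m₁' + m₁)) * normV Γ (κ' + κ + (κ' + κ + (κ' + κ))) ρ₂ Nw / (κ' + κ + (κ' + κ + (κ' + κ))) ^ 2)) * (ρ₂⁻¹ ^ (b' + 1) * (Real.exp 1 * normV Γ (κ' + κ + (κ' + κ + (κ' + κ))) ρ₂ Nw) / (1 - Real.exp 1 * (α' + α + (m₁' + m₁)) * normV Γ (κ' + κ + (κ' + κ + (κ' + κ))) ρ₂ Nw / (κ' + κ + (κ' + κ + (κ' + κ))) ^ 2)))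
            = 4 * ((((a + 1) * (b' + 1) : ℕ) : ℝ) * ((ρ₂⁻¹ ^ (a + 1) * (Real.exp 1 * normV Γ (κ' + κ + (κ' + κ + (κ' + κ))) ρ₂ Nw) / (1 - Real.exp 1 * (α' + α + (m₁' + m₁)) * normV Γ (κ' + κ + (κ' + κ + (κ' + κ))) ρ₂ Nw / (κ' + κ + (κ' + κ + (κ' + κ))) ^ 2)) * (ρ₂⁻¹ ^ (b' + 1) * (Real.exp 1 * normV Γ (κ' + κ + (κ' + κ + (κ' + κ))) ρ₂ Nw) / (1 - Real.exp 1 * (α' + α + (m₁' + m₁)) * normV Γ (κ' + κ + (κ' + κ + (κ' + κ))) ρ₂ Nw / (κ' + κ + (κ' + κ + (κ' + κ))) ^ 2)))) := by ring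
          _ ≤ 4 * ((((a + 1) * (b' + 1) : ℕ) : ℝ) * (ε * (ρ₂⁻¹ ^ (a + 1) * (Real.exp 1 * ν₂) / (1 - Real.exp 1 * (α' + α + (m₁' + m₁)) * ν₂ / (κ' + κ + (κ' + κ + (κ' + κ))) ^ 2)) * (ρ₂⁻¹ ^ (b' + 1) * (Real.exp 1 * ν₂) / (1 - Real.exp 1 * (α' + α + (m₁' + m₁)) * ν₂ / (κ' + κ + (κ' + κ + (κ' + κ))) ^ 2)))) :=
            mul_le_mul_of_nonneg_left (mul_le_mul_of_nonneg_left hP hA) (by norm_num)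
          _ = ε * ((((a + 1) * (b' + 1) : ℕ) : ℝ) * (4 * (ρ₂⁻¹ ^ (a + 1) * (Real.exp 1 * ν₂) / (1 - Real.exp 1 * (α' + α + (m₁' + m₁)) * ν₂ / (κ' + κ + (κ' + κ + (κ' + κ))) ^ 2)) * (ρ₂⁻¹ ^ (b' + 1) * (Real.exp 1 * ν₂) / (1 - Real.exp 1 * (α' + α + (m₁' + m₁)) * ν₂ / (κ' + κ + (κ' + κ + (κ' + κ))) ^ 2)))) := by ring
      · rw [mul_zero]
    simp_rw [← Finset.mul_sum] at hs
    calc ‖(2 : ℂ)⁻¹‖ * _ * T ≤ ‖(2 : ℂ)⁻¹‖ * (ε * ∑ a ∈ range (n + 2), ∑ b' ∈ range (n + 2),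
          (if a + b' = n + 1 then (((a + 1) * (b' + 1) : ℕ) : ℝ) * (4 * (ρ₂⁻¹ ^ (a + 1) * (Real.exp 1 * ν₂) / (1 - Real.exp 1 * (α' + α + (m₁' + m₁)) * ν₂ / (κ' + κ + (κ' + κ + (κ' + κ))) ^ 2)) * (ρ₂⁻¹ ^ (b' + 1) * (Real.exp 1 * ν₂) / (1 - Real.exp 1 * (α' + α + (m₁' + m₁)) * ν₂ / (κ' + κ + (κ' + κ + (κ' + κ))) ^ 2))) else 0)) * T :=
        mul_le_mul_of_nonneg_right (mul_le_mul_of_nonneg_left hs (norm_nonneg _)) hT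
      _ = ε * (T * (‖(2 : ℂ)⁻¹‖ * ∑ a ∈ range (n + 2), ∑ b' ∈ range (n + 2), (if a + b' = n + 1 then (((a + 1) * (b' + 1) : ℕ) : ℝ) * (4 * (ρ₂⁻¹ ^ (a + 1) * (Real.exp 1 * ν₂) / (1 - Real.exp 1 * (α' + α + (m₁' + m₁)) * ν₂ / (κ' + κ + (κ' + κ + (κ' + κ))) ^ 2)) * (ρ₂⁻¹ ^ (b' + 1) * (Real.exp 1 * ν₂) / (1 - Real.exp 1 * (α' + α + (m₁' + m₁)) * ν₂ / (κ' + κ + (κ' + κ + (κ' + κ))) ^ 2))) else 0))) := by ring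
  -- term 7
  have h7 : (((((n + 1 + 1) * (n + 1 + 2) : ℕ) : ℝ) / 2) * (s' + s) * (ρf⁻¹ ^ (n + 3) * (Real.exp 1 * normV Γ (κ' + κ) ρf Nw) / (1 - Real.exp 1 * (α' + α + (m₁' + m₁)) * normV Γ (κ' + κ) ρf Nw / (κ' + κ) ^ 2)) + ‖(2 : ℂ)⁻¹‖ * ∑ a ∈ range (n + 2), ∑ b' ∈ range (n + 2),
      (if a + b' = n + 1 then (((a + 1) * (b' + 1) : ℕ) : ℝ) * (2 * (α' + α) * (ρf⁻¹ ^ (a + 1) * (Real.exp 1 * normV Γ (κ' + κ) ρf Nw) / (1 - Real.exp 1 * (α' + α + (m₁' + m₁)) * normV Γ (κ' + κ) ρf Nw / (κ' + κ) ^ 2)) * (ρf⁻¹ ^ (b' + 1) * (Real.exp 1 * normV Γ (κ' + κ) ρf Nw) / (1 - Real.exp 1 * (α' + α + (m₁' + m₁)) * normV Γ (κ' + κ) ρf Nw / (κ' + κ) ^ 2))) else 0)) * ((R' : ℝ) + 1)⁻¹ ≤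
      ε * (((R' : ℝ) + 1)⁻¹ * (((((n + 1 + 1) * (n + 1 + 2) : ℕ) : ℝ) / 2) * (s' + s) * (ρf⁻¹ ^ (n + 3) * (Real.exp 1 * νf) / (1 - Real.exp 1 * (α' + α + (m₁' + m₁)) * νf / (κ' + κ) ^ 2)) + ‖(2 : ℂ)⁻¹‖ * ∑ a ∈ range (n + 2), ∑ b' ∈ range (n + 2), (if a + b' = n + 1 then (((a + 1) * (b' + 1) : ℕ) : ℝ) * (2 * (α' + α) * (ρf⁻¹ ^ (a + 1) * (Real.exp 1 * νf) / (1 - Real.exp 1 * (α' + α + (m₁' + m₁)) * νf / (κ' + κ) ^ 2)) * (ρf⁻¹ ^ (b' + 1) * (Real.exp 1 * νf) / (1 - Real.exp 1 * (α' + α + (m₁' + m₁)) * νf / (κ' + κ) ^ 2))) else 0))) := by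
    have hs : ∑ a ∈ range (n + 2), ∑ b' ∈ range (n + 2),
        (if a + b' = n + 1 then (((a + 1) * (b' + 1) : ℕ) : ℝ) * (2 * (α' + α) * (ρf⁻¹ ^ (a + 1) * (Real.exp 1 * normV Γ (κ' + κ) ρf Nw) / (1 - Real.exp 1 * (α' + α + (m₁' + m₁)) * normV Γ (κ' + κ) ρf Nw / (κ' + κ) ^ 2)) * (ρf⁻¹ ^ (b' + 1) * (Real.exp 1 * normV Γ (κ' + κ) ρf Nw) / (1 - Real.exp 1 * (α' + α + (m₁' + m₁)) * normV Γ (κ' + κ) ρf Nw / (κ' + κ) ^ 2))) else 0) ≤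
        ∑ a ∈ range (n + 2), ∑ b' ∈ range (n + 2), ε *
          (if a + b' = n + 1 then (((a + 1) * (b' + 1) : ℕ) : ℝ) * (2 * (α' + α) * (ρf⁻¹ ^ (a + 1) * (Real.exp 1 * νf) / (1 - Real.exp 1 * (α' + α + (m₁' + m₁)) * νf / (κ' + κ) ^ 2)) * (ρf⁻¹ ^ (b' + 1) * (Real.exp 1 * νf) / (1 - Real.exp 1 * (α' + α + (m₁' + m₁)) * νf / (κ' + κ) ^ 2))) else 0) := by
      refine sum_le_sum fun a _ => sum_le_sum fun b' _ => ?_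
      split_ifs
      · have hP : (ρf⁻¹ ^ (a + 1) * (Real.exp 1 * normV Γ (κ' + κ) ρf Nw) / (1 - Real.exp 1 * (α' + α + (m₁' + m₁)) * normV Γ (κ' + κ) ρf Nw / (κ' + κ) ^ 2)) * (ρf⁻¹ ^ (b' + 1) * (Real.exp 1 * normV Γ (κ' + κ) ρf Nw) / (1 - Real.exp 1 * (α' + α + (m₁' + m₁)) * normV Γ (κ' + κ) ρf Nw / (κ' + κ) ^ 2)) ≤ ε * (ρf⁻¹ ^ (a + 1) * (Real.exp 1 * νf) / (1 - Real.exp 1 * (α' + α + (m₁' + m₁)) * νf / (κ' + κ) ^ 2)) * (ρf⁻¹ ^ (b' + 1) * (Real.exp 1 * νf) / (1 - Real.exp 1 * (α' + α + (m₁' + m₁)) * νf / (κ' + κ) ^ 2)) :=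
          mul_le_mul (hGf _) (hGf' _) (hGfi0 _) (mul_nonneg hε (hGf0 _))
        have hA : (0 : ℝ) ≤ (((a + 1) * (b' + 1) : ℕ) : ℝ) * (2 * (α' + α)) := by positivity
        calc (((a + 1) * (b' + 1) : ℕ) : ℝ) * (2 * (α' + α) * (ρf⁻¹ ^ (a + 1) * (Real.exp 1 * normV Γ (κ' + κ) ρf Nw) / (1 - Real.exp 1 * (α' + α + (m₁' + m₁)) * normV Γ (κ' + κ) ρf Nw / (κ' + κ) ^ 2)) * (ρf⁻¹ ^ (b' + 1) * (Real.exp 1 * normV Γ (κ' + κ) ρf Nw) / (1 - Real.exp 1 * (α' + α + (m₁' + m₁)) * normV Γ (κ' + κ) ρf Nw / (κ' + κ) ^ 2)))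
            = (((a + 1) * (b' + 1) : ℕ) : ℝ) * (2 * (α' + α)) * ((ρf⁻¹ ^ (a + 1) * (Real.exp 1 * normV Γ (κ' + κ) ρf Nw) / (1 - Real.exp 1 * (α' + α + (m₁' + m₁)) * normV Γ (κ' + κ) ρf Nw / (κ' + κ) ^ 2)) * (ρf⁻¹ ^ (b' + 1) * (Real.exp 1 * normV Γ (κ' + κ) ρf Nw) / (1 - Real.exp 1 * (α' + α + (m₁' + m₁)) * normV Γ (κ' + κ) ρf Nw / (κ' + κ) ^ 2))) := by ring
          _ ≤ (((a + 1) * (b' + 1) : ℕ) : ℝ) * (2 * (α' + α)) * (ε * (ρf⁻¹ ^ (a + 1) * (Real.exp 1 * νf) / (1 - Real.exp 1 * (α' + α + (m₁' + m₁)) * νf / (κ' + κ) ^ 2)) * (ρf⁻¹ ^ (b' + 1) * (Real.exp 1 * νf) / (1 - Real.exp 1 * (α' + α + (m₁' + m₁)) * νf / (κ' + κ) ^ 2))) := mul_le_mul_of_nonneg_left hP hA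
          _ = ε * ((((a + 1) * (b' + 1) : ℕ) : ℝ) * (2 * (α' + α) * (ρf⁻¹ ^ (a + 1) * (Real.exp 1 * νf) / (1 - Real.exp 1 * (α' + α + (m₁' + m₁)) * νf / (κ' + κ) ^ 2)) * (ρf⁻¹ ^ (b' + 1) * (Real.exp 1 * νf) / (1 - Real.exp 1 * (α' + α + (m₁' + m₁)) * νf / (κ' + κ) ^ 2)))) := by ring
      · rw [mul_zero]
    simp_rw [← Finset.mul_sum] at hs
    have hl : ((((n + 1 + 1) * (n + 1 + 2) : ℕ) : ℝ) / 2) * (s' + s) * (ρf⁻¹ ^ (n + 3) * (Real.exp 1 * normV Γ (κ' + κ) ρf Nw) / (1 - Real.exp 1 * (α' + α + (m₁' + m₁)) * normV Γ (κ' + κ) ρf Nw / (κ' + κ) ^ 2)) ≤ ε * (((((n + 1 + 1) * (n + 1 + 2) : ℕ) : ℝ) / 2) * (s' + s) * (ρf⁻¹ ^ (n + 3) * (Real.exp 1 * νf) / (1 - Real.exp 1 * (α' + α + (m₁' + m₁)) * νf / (κ' + κ) ^ 2))) :=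
      calc ((((n + 1 + 1) * (n + 1 + 2) : ℕ) : ℝ) / 2) * (s' + s) * (ρf⁻¹ ^ (n + 3) * (Real.exp 1 * normV Γ (κ' + κ) ρf Nw) / (1 - Real.exp 1 * (α' + α + (m₁' + m₁)) * normV Γ (κ' + κ) ρf Nw / (κ' + κ) ^ 2)) ≤ ((((n + 1 + 1) * (n + 1 + 2) : ℕ) : ℝ) / 2) * (s' + s) * (ε * (ρf⁻¹ ^ (n + 3) * (Real.exp 1 * νf) / (1 - Real.exp 1 * (α' + α + (m₁' + m₁)) * νf / (κ' + κ) ^ 2))) := mul_le_mul_of_nonneg_left (hGf _) (by positivity)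
        _ = ε * (((((n + 1 + 1) * (n + 1 + 2) : ℕ) : ℝ) / 2) * (s' + s) * (ρf⁻¹ ^ (n + 3) * (Real.exp 1 * νf) / (1 - Real.exp 1 * (α' + α + (m₁' + m₁)) * νf / (κ' + κ) ^ 2))) := by ring
    have hq : (0 : ℝ) ≤ ((R' : ℝ) + 1)⁻¹ := by positivity
    calc _ ≤ (ε * (((((n + 1 + 1) * (n + 1 + 2) : ℕ) : ℝ) / 2) * (s' + s) * (ρf⁻¹ ^ (n + 3) * (Real.exp 1 * νf) / (1 - Real.exp 1 * (α' + α + (m₁' + m₁)) * νf / (κ' + κ) ^ 2))) + ‖(2 : ℂ)⁻¹‖ * (ε * ∑ a ∈ range (n + 2), ∑ b' ∈ range (n + 2),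
          (if a + b' = n + 1 then (((a + 1) * (b' + 1) : ℕ) : ℝ) * (2 * (α' + α) * (ρf⁻¹ ^ (a + 1) * (Real.exp 1 * νf) / (1 - Real.exp 1 * (α' + α + (m₁' + m₁)) * νf / (κ' + κ) ^ 2)) * (ρf⁻¹ ^ (b' + 1) * (Real.exp 1 * νf) / (1 - Real.exp 1 * (α' + α + (m₁' + m₁)) * νf / (κ' + κ) ^ 2))) else 0))) * ((R' : ℝ) + 1)⁻¹ :=
        mul_le_mul_of_nonneg_right (add_le_add hl (mul_le_mul_of_nonneg_left hs (norm_nonneg _))) hq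
      _ = ε * (((R' : ℝ) + 1)⁻¹ * (((((n + 1 + 1) * (n + 1 + 2) : ℕ) : ℝ) / 2) * (s' + s) * (ρf⁻¹ ^ (n + 3) * (Real.exp 1 * νf) / (1 - Real.exp 1 * (α' + α + (m₁' + m₁)) * νf / (κ' + κ) ^ 2)) + ‖(2 : ℂ)⁻¹‖ * ∑ a ∈ range (n + 2), ∑ b' ∈ range (n + 2), (if a + b' = n + 1 then (((a + 1) * (b' + 1) : ℕ) : ℝ) * (2 * (α' + α) * (ρf⁻¹ ^ (a + 1) * (Real.exp 1 * νf) / (1 - Real.exp 1 * (α' + α + (m₁' + m₁)) * νf / (κ' + κ) ^ 2)) * (ρf⁻¹ ^ (b' + 1) * (Real.exp 1 * νf) / (1 - Real.exp 1 * (α' + α + (m₁' + m₁)) * νf / (κ' + κ) ^ 2))) else 0))) := by ring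
  -- total
  linarith [h1, h2, h3, h4, h5, h6, h7]

end Summit.HubbardSuperconductivity.HubbardSuperconductivity.Theorems.TwoVolumeSource

end
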